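import Literature.NumberTheory.LFunctions.Zhang2022.KnifeEdgeEStarLen

/-!
# Zhang (2022), rung F-S3 (Landau–Siegel programme, §D edge len = E*-len⁺): ls-knife-len-idea-1's barrier memo BN1
# «the bulk × band cross term has an EMPTY family diagonal (class χψ)» — its typing targets (evidence row «E-006⁻»)

Y. Zhang, *Discrete mean estimates and the Landau–Siegel zero*, arXiv:2211.02515v1 [Zhang2022LandauSiegel] — an
unrefereed manuscript under adjudication. **WHAT THIS IS NOT: not a claim about Theorems 1–2 of arXiv:2211.02515, about
Landau–Siegel zeros, or about Parity. The programme SEARCHES and TYPES; no claim about Landau–Siegel zeros, Theorems 1–2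
of arXiv:2211.02515 or a repaired Margin232 until a kernel theorem says so. `BandCrossNegligible` is a bare `Prop` —
the memo's heuristic derivation (Gauss-sum count + sizes), status «derivation», asserted by no one; the other
declarations are definitions and one sanity lemma.**

SOURCE: HOME/knife/len/idea-1/BARRIER-band-cross-empty-diagonal.md (ls-knife-len-idea-1 g0, 2026-08-26T20:30Z) and its
sketch `BN1-crossStat.lean` (farm rc 0), typed verbatim by ls-knife-typer-1 (cell landau-siegel §D).  CLAIM (BN1): for
ANY admissible bulk piece `H_u` (length `≤ P/T²`) and ANY band piece `S_v` (coefficients on `P < n ≤ PDt₀`: jump at the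
wall, rough, PPE …) the (A)-world cross term `2Re ΣΣ Re𝔠*·Reω·H_u·conj S_v` is `o(𝔓)` while the band variance is
`≥ 0` (E-005) — hence no length lever for class `χψ` whatever the profile regularity.  Mechanism: S1 (approximate
functional equation) writes a band piece as `−Z(ρ,ψχ)·conj Q_v(ρ,ψ)` with a SHORT side-2 polynomial `Q_v` (log-length
`≤ α̃`), so the cross term is the `Ξ₁₃`-shape statistic `crossStat` below; S2 (the count): on `𝔍(1)` Kloosterman + Weil,
on `𝔍(0)` the congruence `n ≡ Dm (mod p)` with `n < p/T` forces `n = Dm`, `χ(Dm) = 0` — the diagonal is EMPTY (it is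
non-empty exactly past the range wall (R-e) `ν₁ + ν₂ > 1`, where Zhang's genuine `Ξ₁₃` main term lives).  Relation to
the rows of record: this is the mechanism the registry's E-006 «expected o(𝔅-scale)» lacked (`KnifeEdgeWallCross.ECrossBand`
states the same expectation over the discrete polar form of the wall design; `crossStat` is its reflected, `Z⁻¹`-weighted
`Ξ₁₃` form).  What it would decide if derived: REDUCTION-MAP-len rows L-a (rough / jump / comb band designs) and the
«c_X mechanism» escape — closing (O1) for class `χψ`.

## References
* Y. Zhang, arXiv:2211.02515v1 (2022), §2 (2.29), (2.32); §8 (8.5), Lemma 8.1. [cite: Zhang2022LandauSiegel, §2, §8]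
-/

open Complex Real ComplexConjugate

noncomputable section

namespace Literature.NumberTheory.LFunctions.Zhang2022.KnifeEdge

open Repair Skeleton

/-- A short in-class ("side-2") polynomial `Q(s,ψ) = Σ_{1≤m<M} q(m)·χψ(m)·m^{−s}` with arbitrary bounded
coefficients `q` (the AFE dual weights of a band piece). [cite: Zhang2022LandauSiegel, §2 (2.29), (2.32); §8 (8.5)] -/
def shortPoly {D : ℕ} (χ : DirichletCharacter ℂ D) (x : Chr D) (q : ℕ → ℂ) (M : ℕ) (s : ℂ) : ℂ :=
  ∑ m ∈ Finset.Ico 1 M, q m * pc χ x m * (m : ℂ) ^ (-s)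

variable (c' : ℝ) {D : ℕ} [NeZero D] (χ : DirichletCharacter ℂ D)

/-- The `Ξ₁₃`-shape cross statistic `ΣΣ 𝔠*(ρ,ψ)·Z(ρ,ψχ)⁻¹·H_g(ρ,ψ)·Q(ρ,ψ)·ω(ρ)` between a bulk profile
polynomial and a short side-2 polynomial (`Skeleton.xi13` is the instance `H_g = H₁`, `Q = H₂`). [cite: Zhang2022LandauSiegel, §8 (8.5)] -/
def crossStat (g : ℝ → ℂ) (N : ℕ) (q : ℕ → ℂ) (M : ℕ) : ℂ :=
  ∑ i ∈ idx χ, cstar c' D i.1 i.2 * (Zpc χ i.1 i.2)⁻¹ *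
    (profPoly χ i.1 g N i.2 * shortPoly χ i.1 q M i.2) * omegaW D i.2

/-- Sanity: with no bulk (`N ≤ 1`) the statistic vanishes. [cite: Zhang2022LandauSiegel, §8 (8.5)] -/
theorem crossStat_length_le_one (g : ℝ → ℂ) {N : ℕ} (hN : N ≤ 1) (q : ℕ → ℂ) (M : ℕ) :
    crossStat c' χ g N q M = 0 := by
  unfold crossStat profPoly
  have : Finset.Ico 1 N = ∅ := Finset.Ico_eq_empty (by omega)
  simp [this]

/-- **BN1 / «E-006⁻» (evidence row, kind: derivation).** The bulk × short-side-2 cross statistic is `o(𝔞𝔓)`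
whenever `len₁·len₂·T² ≤ P·D·t₀` (so for every bulk of length `≤ P/T²` against every band piece).  OPEN — asserted by
no one; the memo's mechanism: on `𝔍(1)` the family weight is `τ(ψ̄)²ψ̄(D)` ⇒ Kloosterman `S(1, mnD̄; p)` + Weil; on `𝔍(0)`
no Gauss sum survives, the congruence `n ≡ Dm (mod p)` with `n < p/T` forces `n = Dm` and `χ(Dm) = 0` — the family
diagonal is EMPTY (it is non-empty exactly beyond the range wall (R-e) `ν₁ + ν₂ > 1`, where Zhang's `Ξ₁₃` main term lives).
[cite: Zhang2022LandauSiegel, §8 (8.5), Lemma 8.1; §2 (2.32)] -/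
def BandCrossNegligible : Prop :=
  ∀ ε : ℝ, 0 < ε → ForAllLarge fun D _ χ => AssumptionA D χ →
    ∀ g : ℝ → ℂ, (∀ z, ‖g z‖ ≤ 1) → Measurable g →
    ∀ q : ℕ → ℂ, (∀ m, ‖q m‖ ≤ 1) →
    ∀ N M : ℕ, (N : ℝ) * M * bigT D ^ 2 ≤ bigP D * D * t0 D →
      ‖crossStat c' χ g N q M‖ ≤ ε * frakA χ * frakP D

/-- The two-sided design value `H_g(ρ,ψ) + c·Z(ρ,ψχ)·conj Q(ρ,ψ)` (Zhang's shape (2.32) with a SHORT side 2 — by the memo's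
step S1 (approximate functional equation of `L(s,χψ)`, conductor `pD`) every side-1 BAND piece is `−Z(ρ,ψχ)·conj Q(ρ,ψ)` up to a
negligible error, `Q` of log-length `≤ α̃`). [cite: Zhang2022LandauSiegel, §2 (2.32)] -/
def twoSided (g : ℝ → ℂ) (N : ℕ) (c : ℂ) (q : ℕ → ℂ) (M : ℕ) (x : Chr D) (s : ℂ) : ℂ :=
  profPoly χ x g N s + c * Zpc χ x s * conj (shortPoly χ x q M s)

/-- In the two-sided value the side-2 coefficient `c = 0` recovers the bulk polynomial. [cite: Zhang2022LandauSiegel, §2 (2.32)] -/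
theorem twoSided_zero (g : ℝ → ℂ) (N : ℕ) (q : ℕ → ℂ) (M : ℕ) (x : Chr D) (s : ℂ) :
    twoSided χ g N 0 q M x s = profPoly χ x g N s := by
  simp [twoSided]

end Literature.NumberTheory.LFunctions.Zhang2022.KnifeEdge

end
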